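import Literature.ModelTheory.ExponentialFields.SemialgebraicC1TriangulationLifting
import HarnessLib

/-!
# Orthogonal `1`-flatness along simplices ([Pawlucki2024, §6], `p = 1`)

Topic `Literature/ModelTheory/ExponentialFields` — vocabulary for blocks B7/B8 of the proof of
the `C¹`-triangulation theorem for compact semialgebraic sets
(`Literature.ModelTheory.ExponentialFields.OhmotoShiota2017_c1Triangulation`) along
[Pawlucki2024], specialized to `p = 1`.

[Pawlucki2024, §6, definition before Remark 6.2] (`p = 1`): a `C¹` map `f` on `D ⊇ Δ` is
*orthogonally `1`-flat along* the (open) simplex `Δ` if `Df(u) w = 0` for all `u ∈ Δ` and all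
`w` orthogonal to `Aff(Δ)`. We use the dot product of `ℝⁿ = Fin n → ℝ` and the derivative within
`D` (`fderivWithin`), so that maps `C¹` on closed polyhedra are covered.

No named facts are introduced (D-0026).

## References

* [Pawlucki2024] W. Pawłucki, *Strict `C^p`-triangulations — a new approach to
  desingularization*, J. Eur. Math. Soc. 26 (2024), 3863–3909, §6 (Remark 6.2, Theorem 6.3, Corollary 6.5).
-/

noncomputable section

open Set

namespace Literature.ModelTheory.ExponentialFields

section OrthFlat

variable {n : ℕ} {E : Type*} [NormedAddCommGroup E] [NormedSpace ℝ E]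

/-- `w` is orthogonal (for the dot product) to the direction of the simplex spanned by `σ`.
[cite: Pawlucki2024, §6 (Remark 6.2)] -/
def IsOrthTo (σ : Finset (Fin n → ℝ)) (w : Fin n → ℝ) : Prop :=
  ∀ v ∈ vectorSpan ℝ (σ : Set (Fin n → ℝ)), w ⬝ᵥ v = 0

/-- **Orthogonal `1`-flatness along a simplex** [Pawlucki2024, §6] (`p = 1`), for a map
differentiable within `D`: the derivative within `D` kills the normal directions at every point of
the open simplex. [cite: Pawlucki2024, §6 (definition before Remark 6.2)] -/
def IsOrthFlatAlongWithin (f : (Fin n → ℝ) → E) (D : Set (Fin n → ℝ)) (σ : Finset (Fin n → ℝ)) : Prop :=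
  ∀ x ∈ openSimplex ℝ σ, ∀ w : Fin n → ℝ, IsOrthTo σ w → fderivWithin ℝ f D x w = 0

/-- Orthogonal `1`-flatness along a simplex for a map differentiable on a neighbourhood.
[cite: Pawlucki2024, §6 (definition before Remark 6.2)] -/
def IsOrthFlatAlong (f : (Fin n → ℝ) → E) (σ : Finset (Fin n → ℝ)) : Prop :=
  ∀ x ∈ openSimplex ℝ σ, ∀ w : Fin n → ℝ, IsOrthTo σ w → fderiv ℝ f x w = 0

/-- The zero vector is orthogonal to every simplex. [cite: Pawlucki2024, §6] -/
theorem isOrthTo_zero (σ : Finset (Fin n → ℝ)) : IsOrthTo σ 0 := fun v _ => by simp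

/-- Orthogonal vectors form a submodule (closure under addition). [cite: Pawlucki2024, §6] -/
theorem IsOrthTo.add {σ : Finset (Fin n → ℝ)} {w w' : Fin n → ℝ} (h : IsOrthTo σ w) (h' : IsOrthTo σ w') :
    IsOrthTo σ (w + w') := fun v hv => by rw [add_dotProduct, h v hv, h' v hv, add_zero]

/-- Orthogonal vectors form a submodule (closure under scalars). [cite: Pawlucki2024, §6] -/
theorem IsOrthTo.smul {σ : Finset (Fin n → ℝ)} {w : Fin n → ℝ} (h : IsOrthTo σ w) (c : ℝ) :
    IsOrthTo σ (c • w) := fun v hv => by rw [smul_dotProduct, h v hv, smul_zero]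

/-- On the universal set both notions agree. [cite: Pawlucki2024, §6] -/
theorem isOrthFlatAlongWithin_univ {f : (Fin n → ℝ) → E} {σ : Finset (Fin n → ℝ)} :
    IsOrthFlatAlongWithin f univ σ ↔ IsOrthFlatAlong f σ := by
  simp only [IsOrthFlatAlongWithin, IsOrthFlatAlong, fderivWithin_univ]

/-- A top-dimensional simplex imposes no condition: if the direction of `σ` is everything, only
`w = 0` is orthogonal. [cite: Pawlucki2024, §6] -/
theorem IsOrthTo.eq_zero_of_top {σ : Finset (Fin n → ℝ)} (hσ : vectorSpan ℝ (σ : Set (Fin n → ℝ)) = ⊤)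
    {w : Fin n → ℝ} (h : IsOrthTo σ w) : w = 0 := by
  have hw : w ⬝ᵥ w = 0 := h w (by rw [hσ]; trivial)
  exact dotProduct_self_eq_zero.1 hw

/-- Sums of orthogonally flat maps are orthogonally flat (within a set with unique derivatives).
[cite: Pawlucki2024, §6] -/
theorem IsOrthFlatAlongWithin.add {f g : (Fin n → ℝ) → E} {D : Set (Fin n → ℝ)} {σ : Finset (Fin n → ℝ)}
    (hf : IsOrthFlatAlongWithin f D σ) (hg : IsOrthFlatAlongWithin g D σ)
    (hD : UniqueDiffOn ℝ D) (hσD : openSimplex ℝ σ ⊆ D)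
    (hfd : ∀ x ∈ openSimplex ℝ σ, DifferentiableWithinAt ℝ f D x) (hgd : ∀ x ∈ openSimplex ℝ σ, DifferentiableWithinAt ℝ g D x) :
    IsOrthFlatAlongWithin (f + g) D σ := by
  intro x hx w hw
  rw [fderivWithin_add (hD x (hσD hx)) (hfd x hx) (hgd x hx), add_apply, hf x hx w hw, hg x hx w hw, add_zero]

end OrthFlat

end Literature.ModelTheory.ExponentialFields
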